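import Summits.BirchSwinnertonDyer.Rank1Residual.P2.CongruentNumberPairsAtTwoOddPairTable
import HarnessLib

/-!
# Sub-lane «bsd-p2»: the ODD Monsky law below the blind line — rungs `k = 1, 2` are THEOREMS, rung
# `k = 3` ⟺ the odd `U₃⁰` sentence = typer draft `CongruentSilentFiveSevenSevenBSDTwo` (LANDING-QUEUE C5/C6,
# NOT in the tree; SWEEP 2026-08-24 candidate (d)) — NOT the qualified even law C-P2-2 of
# `P2/Conjectures/CongruentNumberEvenMonskyLawAtTwo.lean` (p2-typer GEN 22 terms; W0 docstrings typer GEN 62,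
# T-186; the odd twin of GEN 21's even rung-two closed form; W0 candidate for SWEEP 2026-08-24 ORDER 2)

HONEST FRAMING (sub-lane «bsd-p2», run/shared/lean/b2b/bsd-rank1-residual/p2/, verbatim in every
file): the target of record is the FULL Birch–Swinnerton-Dyer formula for EVERY analytic-rank `≤ 1`
`E/ℚ` at ALL primes INCLUDING `2`; the odd-prime class ledger is referee A's; the `2`-part is OPEN
(cells O1 = X5 ∖ CM and O12 = the CM corner) and under census by «bsd-p2». Census / instrument
output at `2` = EVIDENCE / conjecture items with held-out validation, NEVER a Literature fact;
certificates close PAIRS (one isogeny class, `p = 2`), never classes. This file asserts NO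
arithmetic fact: every statement is a CONDITIONAL kernel theorem under the displayed binders `hTYZ`
(Tian–Yuan–Zhang §3 displayed, `tyz_genusPointData`), `hGZK`, `hM` (Monsky 1994 odd), `hR`
(Rédei–Reichardt), or a bookkeeping implication / equivalence between two ∀-sentences; the odd `U₃⁰`
sentence (typer draft `CongruentSilentFiveSevenSevenBSDTwo`, LANDING-QUEUE C5/C6, NOT in the tree) is
neither assumed nor proved — its OBSERVABLE sentence is spelled out inline, byte-parallel to the draft.
WHAT IT DOES. The ODD Monsky law is the uniform sentence «for every `k` and all distinct primes
`t₀, …, t_{k−1}` with `n = ∏ tᵢ ≡ 5, 7 (mod 8)` and Monsky's `s(n) = 1`: `ord_{s=1} L(E_n, s) = 1` and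
`BSD(E_n, 2)`» (its `k`-th instance = RUNG `k`). §5: rungs `1` and `2` are THEOREMS modulo the four
facts (the pair table of `P2/CongruentNumberPairsAtTwoOddPairTable.lean`: no silent odd cell at
`k ≤ 2`). §6: rung `3` IMPLIES the odd `U₃⁰` sentence with NO fact (`s = 1` on `U₃⁰` is linear algebra,
p346251) and FOLLOWS from it modulo the four facts (ATLAS-A3: at `ω = 3` the silent cells are exactly the
exceptional class-`5` family, `…_three_primes_five` / `…_three_primes_seven`). §7: hence the law
restricted to `k ≤ 3` ⟺ the odd `U₃⁰` sentence — ONE odd token quantified from `k = 1` asserts below the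
blind rungs `k ≥ 4` EXACTLY the odd `U₃⁰` sentence (kernel, both directions). Nothing booked; no mark
moved; no `ℓ = 4` or odd `k ≥ 4` integer touched. Unit `b2b-bsdres-p2-typer` GEN 22 (terms) / GEN 62 (W0
docstring refresh T-186, decl terms byte-identical); W0 candidate for SWEEP 2026-08-24 ORDER 2 (door-side
bookkeeping; `U₃⁰` UNMEASURED; no registration rides on this file); elaborable once the pair-table file is
in the tree.

References: [HeathBrown1994SelmerCongruentII] Appendix (Monsky), typescript p. 39 L10–L33;
[TianYuanZhang2017] Thm 1.2, Thm 3.5, §1 (1.1); [IrelandRosen1990] Ch. 5 §1–§2; [Miller2011LMS]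
Def 1.1; HOME/p2/typer/LANDING-QUEUE.md rows C5/C6 (the odd `U₃⁰` sentence);
HOME/p2/typer/lean/conjectures/GEN21-EVEN-RUNG-TWO.md.
-/

noncomputable section

open scoped Classical

open Matrix Finset WeierstrassCurve NumberField Literature.NumberTheory.EllipticCurves
  Literature.NumberTheory.EllipticCurves.Rank1Residual
  Literature.NumberTheory.EllipticCurves.Rank1Residual.Typed
  Literature.NumberTheory.EllipticCurves.Monsky1990
  Literature.NumberTheory.EllipticCurves.HeathBrown1994
  Literature.NumberTheory.EllipticCurves.TianYuanZhang2017
  Literature.NumberTheory.EllipticCurves.Tian2014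
  Literature.NumberTheory.QuadraticFields.RedeiReichardt

set_option autoImplicit false

namespace Summit.BirchSwinnertonDyer.Rank1Residual.P2

/-! ## §5 The rungs of the ODD Monsky law in LAW FORM (observable conclusion `r_an = 1 ∧ BSD(E_n, 2)`;
the `k`-th rung = the uniform sentence «for all `k` distinct primes with `∏ tᵢ ≡ 5, 7 (mod 8)` and
`s(∏ tᵢ) = 1`: `ord_{s=1} L(E_n, s) = 1` and `BSD(E_n, 2)`» at that `k`) -/

section Rungs

/-- **RUNG ONE of the odd law is a THEOREM** modulo {`hTYZ`, `hGZK`, `hM`, `hR`} (every prime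
`p ≡ 5, 7 (mod 8)`; the hypothesis `s = 1` is automatic, §2, and not used).
[cite: TianYuanZhang2017, Thm. 1.2, Thm. 3.5 and §1 (1.1)] [cite: Miller2011LMS, Def. 1.1 (arXiv:1010.2431 p. 3)] -/
theorem oddRung_one (hTYZ : tyz_genusPointData) (hGZK : rank_eq_analyticRank_of_analyticRank_le_one)
    (hM : monsky_card_selmerGroup_two_odd) (hR : redeiReichardt_fourTwoCard_classGroup) :
    ∀ t : Fin 1 → ℕ, (∀ i, (t i).Prime) → Function.Injective t →
      ((∏ i, t i) % 8 = 5 ∨ (∏ i, t i) % 8 = 7) → monskySelmerRankOdd t = 1 →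
      (congruentNumberCurve (∏ i, t i)).analyticRank = 1 ∧ BSDp (congruentNumberCurve (∏ i, t i)) 2 := by
  intro t ht _ h8 _
  rw [Fin.prod_univ_one] at h8 ⊢
  have h := rankOne_sha_bsdp_two_congruentNumberCurve_prime_five_or_seven hTYZ hGZK hM hR (ht 0) h8
  exact ⟨h.1, h.2.2.2⟩

/-- **RUNG TWO of the odd law is a THEOREM** modulo {`hTYZ`, `hGZK`, `hM`, `hR`} (§4: no silent pair).
[cite: TianYuanZhang2017, Thm. 1.2, Thm. 3.5 and §1 (1.1)]
[cite: HeathBrown1994SelmerCongruentII, Appendix (Monsky), typescript p. 39 L10–L33]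
[cite: Miller2011LMS, Def. 1.1 (arXiv:1010.2431 p. 3)] -/
theorem oddRung_two (hTYZ : tyz_genusPointData) (hGZK : rank_eq_analyticRank_of_analyticRank_le_one)
    (hM : monsky_card_selmerGroup_two_odd) (hR : redeiReichardt_fourTwoCard_classGroup) :
    ∀ t : Fin 2 → ℕ, (∀ i, (t i).Prime) → Function.Injective t →
      ((∏ i, t i) % 8 = 5 ∨ (∏ i, t i) % 8 = 7) → monskySelmerRankOdd t = 1 →
      (congruentNumberCurve (∏ i, t i)).analyticRank = 1 ∧ BSDp (congruentNumberCurve (∏ i, t i)) 2 := by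
  intro t ht hinj h8 hs
  have h := rankOne_sha_bsdp_two_congruentNumberCurve_odd_pair hTYZ hGZK hM hR t ht hinj rfl h8 hs
  exact ⟨h.1, h.2.2.2⟩

/-! ## §6 RUNG THREE ⟺ the odd `U₃⁰` sentence (its OBSERVABLE sentence stated inline —
byte-parallel to the typer's draft `CongruentSilentFiveSevenSevenBSDTwo`; no unlanded import) -/

/-- **Rung three ⟹ the odd `U₃⁰` sentence, with NO fact**: on `U₃⁰ = {p₅q₇r₇ : (q/p) = (r/p) = −1}`
Monsky's matrix has a
`2`-element kernel by linear algebra (p346251's `card_ker_monskyMatrixOdd_of_exceptionalFiveCfg`), so the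
rung applies verbatim. [cite: HeathBrown1994SelmerCongruentII, Appendix (Monsky), typescript p. 39 L27–L33]
[cite: IrelandRosen1990, Ch. 5 §1 Prop. 5.1.2] [cite: Miller2011LMS, Def. 1.1 (arXiv:1010.2431 p. 3)] -/
theorem silentFiveSevenSeven_of_oddRung_three
    (h : ∀ t : Fin 3 → ℕ, (∀ i, (t i).Prime) → Function.Injective t →
      ((∏ i, t i) % 8 = 5 ∨ (∏ i, t i) % 8 = 7) → monskySelmerRankOdd t = 1 →
      (congruentNumberCurve (∏ i, t i)).analyticRank = 1 ∧ BSDp (congruentNumberCurve (∏ i, t i)) 2) :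
    ∀ p q r : ℕ, p.Prime → q.Prime → r.Prime → p % 8 = 5 → q % 8 = 7 → r % 8 = 7 → q ≠ r →
      jacobiSym q p = -1 → jacobiSym r p = -1 →
        (congruentNumberCurve (p * q * r)).analyticRank = 1 ∧
          BSDp (congruentNumberCurve (p * q * r)) 2 := by
  intro p q r hp hq hr hp5 hq7 hr7 hqr hqp hrp
  obtain ⟨ht, hinj, hexc⟩ := exceptionalFiveCfg_of_five_seven_seven hp hq hr hp5 hq7 hr7 hqr hqp hrp
  have hn : ∏ i, ![p, q, r] i = p * q * r := by rw [Fin.prod_univ_three]; rfl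
  have h5 : (p * q * r) % 8 = 5 := by rw [Nat.mul_mod (p * q) r, Nat.mul_mod p q, hp5, hq7, hr7]
  have hs : monskySelmerRankOdd ![p, q, r] = 1 :=
    (monskySelmerRankOdd_eq_one_iff_card_ker _).mpr
      (card_ker_monskyMatrixOdd_of_exceptionalFiveCfg _ ht hinj hexc)
  have key := h ![p, q, r] ht hinj (Or.inl (by rw [hn]; exact h5)) hs
  rwa [hn] at key

/-- **The odd `U₃⁰` sentence ⟹ rung three**, modulo {`hTYZ`, `hGZK`, `hM`, `hR`}: at `ω = 3` a triple with
`s = 1` and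
`n ≡ 7 (mod 8)` is LOUD (`…_three_primes_seven`), one with `n ≡ 5 (mod 8)` is LOUD unless it is an
exceptional class-`5` configuration (`…_three_primes_five`), and the exceptional ones ARE `U₃⁰` — read
off the configuration (`exceptionalFiveCfg`, Euler's criterion `kroneckerBit_eq_one_iff_jacobiSym`) and
handed to the hypothesis. [cite: TianYuanZhang2017, Thm. 1.2, Thm. 3.5 and §1 (1.1)]
[cite: HeathBrown1994SelmerCongruentII, Appendix (Monsky), typescript p. 39 L10–L33]
[cite: IrelandRosen1990, Ch. 5 §1 Prop. 5.1.2] [cite: Miller2011LMS, Def. 1.1 (arXiv:1010.2431 p. 3)] -/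
theorem oddRung_three_of_silentFiveSevenSeven (hTYZ : tyz_genusPointData)
    (hGZK : rank_eq_analyticRank_of_analyticRank_le_one) (hM : monsky_card_selmerGroup_two_odd)
    (hR : redeiReichardt_fourTwoCard_classGroup)
    (hC : ∀ p q r : ℕ, p.Prime → q.Prime → r.Prime → p % 8 = 5 → q % 8 = 7 → r % 8 = 7 → q ≠ r →
      jacobiSym q p = -1 → jacobiSym r p = -1 →
        (congruentNumberCurve (p * q * r)).analyticRank = 1 ∧
          BSDp (congruentNumberCurve (p * q * r)) 2) :
    ∀ t : Fin 3 → ℕ, (∀ i, (t i).Prime) → Function.Injective t →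
      ((∏ i, t i) % 8 = 5 ∨ (∏ i, t i) % 8 = 7) → monskySelmerRankOdd t = 1 →
      (congruentNumberCurve (∏ i, t i)).analyticRank = 1 ∧ BSDp (congruentNumberCurve (∏ i, t i)) 2 := by
  intro t ht hinj h8 hs
  have hker := (monskySelmerRankOdd_eq_one_iff_card_ker t).mp hs
  have ht2 : ∀ i, t i ≠ 2 := by
    intro i hi
    have hdvd : t i ∣ ∏ j, t j := Finset.dvd_prod_of_mem t (Finset.mem_univ i)
    rw [hi] at hdvd
    rcases h8 with h | h <;> omega
  rcases h8 with h5 | h7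
  · by_cases hexc : exceptionalFiveCfg (fun i => t i % 8) (fun a b => kroneckerBit (t b) (t a)) = true
    · -- the silent cell: read `(p, q, r)` off the configuration and use the hypothesis `hC`
      have main : ∀ i j l : Fin 3, j ≠ i → l ≠ i → j ≠ l → t i % 8 = 5 →
          (t j % 8 = 7 ∧ kroneckerBit (t j) (t i) = 1) → (t l % 8 = 7 ∧ kroneckerBit (t l) (t i) = 1) →
          (congruentNumberCurve (t i * t j * t l)).analyticRank = 1 ∧
            BSDp (congruentNumberCurve (t i * t j * t l)) 2 := by
        intro i j l hji hli hjl hi5 hj hl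
        have htji : t j ≠ t i := fun e => hji (hinj e)
        have htli : t l ≠ t i := fun e => hli (hinj e)
        have hJj : jacobiSym (t j : ℤ) (t i) = -1 :=
          (kroneckerBit_eq_one_iff_jacobiSym (ht i) (ht2 i)
            (intCast_natCast_prime_ne_zero (ht j) (ht i) htji)).mp hj.2
        have hJl : jacobiSym (t l : ℤ) (t i) = -1 :=
          (kroneckerBit_eq_one_iff_jacobiSym (ht i) (ht2 i)
            (intCast_natCast_prime_ne_zero (ht l) (ht i) htli)).mp hl.2
        exact hC (t i) (t j) (t l) (ht i) (ht j) (ht l) hi5 hj.1 hl.1 (fun e => hjl (hinj e)) hJj hJl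
      rw [exceptionalFiveCfg, decide_eq_true_eq] at hexc
      obtain ⟨i, hi5, hij⟩ := hexc
      simp only [Nat.mod_mod] at hi5 hij
      have e3 : ∏ j, t j = t 0 * t 1 * t 2 := Fin.prod_univ_three t
      fin_cases i
      · have := main 0 1 2 (by decide) (by decide) (by decide) hi5 (hij 1 (by decide)) (hij 2 (by decide))
        rwa [e3]
      · have := main 1 0 2 (by decide) (by decide) (by decide) hi5 (hij 0 (by decide)) (hij 2 (by decide))
        rw [e3, show t 0 * t 1 * t 2 = t 1 * t 0 * t 2 by ring]; exact this
      · have := main 2 0 1 (by decide) (by decide) (by decide) hi5 (hij 0 (by decide)) (hij 1 (by decide))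
        rw [e3, show t 0 * t 1 * t 2 = t 2 * t 0 * t 1 by ring]; exact this
    · have h := rankOne_sha_bsdp_two_congruentNumberCurve_three_primes_five t hTYZ hGZK hM hR ht hinj rfl
        h5 hker (Bool.eq_false_iff.mpr hexc)
      exact ⟨h.1, h.2.2.2⟩
  · have h := rankOne_sha_bsdp_two_congruentNumberCurve_three_primes_seven t hTYZ hGZK hM hR ht hinj rfl
      h7 hker
    exact ⟨h.1, h.2.2.2⟩

/-- **RUNG THREE ⟺ the odd `U₃⁰` sentence**, modulo {`hTYZ`, `hGZK`, `hM`, `hR`} — the odd twin of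
the even `rung_two_iff_congruentSilentEvenFiveBSDTwo` (typer GEN 21): at `ω = 3` the silent odd cells are
EXACTLY the exceptional class-`5` family. [cite: TianYuanZhang2017, Thm. 1.2, Thm. 3.5 and §1 (1.1)]
[cite: HeathBrown1994SelmerCongruentII, Appendix (Monsky), typescript p. 39 L10–L33]
[cite: Miller2011LMS, Def. 1.1 (arXiv:1010.2431 p. 3)] -/
theorem oddRung_three_iff_silentFiveSevenSeven (hTYZ : tyz_genusPointData)
    (hGZK : rank_eq_analyticRank_of_analyticRank_le_one) (hM : monsky_card_selmerGroup_two_odd)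
    (hR : redeiReichardt_fourTwoCard_classGroup) :
    (∀ t : Fin 3 → ℕ, (∀ i, (t i).Prime) → Function.Injective t →
      ((∏ i, t i) % 8 = 5 ∨ (∏ i, t i) % 8 = 7) → monskySelmerRankOdd t = 1 →
      (congruentNumberCurve (∏ i, t i)).analyticRank = 1 ∧ BSDp (congruentNumberCurve (∏ i, t i)) 2) ↔
    (∀ p q r : ℕ, p.Prime → q.Prime → r.Prime → p % 8 = 5 → q % 8 = 7 → r % 8 = 7 → q ≠ r →
      jacobiSym q p = -1 → jacobiSym r p = -1 →
        (congruentNumberCurve (p * q * r)).analyticRank = 1 ∧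
          BSDp (congruentNumberCurve (p * q * r)) 2) :=
  ⟨silentFiveSevenSeven_of_oddRung_three, oddRung_three_of_silentFiveSevenSeven hTYZ hGZK hM hR⟩

end Rungs

/-! ## §7 THE ODD LAW BELOW THE BLIND LINE: rungs `k ≤ 3` ⟺ the odd `U₃⁰` sentence -/

section Law

/-- **The odd Monsky law restricted to `k ≤ 3` IMPLIES the odd `U₃⁰` sentence with NO fact** (specialise to
`k = 3`).
[cite: HeathBrown1994SelmerCongruentII, Appendix (Monsky), typescript p. 39 L27–L33]
[cite: Miller2011LMS, Def. 1.1 (arXiv:1010.2431 p. 3)] -/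
theorem silentFiveSevenSeven_of_oddLaw_le_three
    (h : ∀ k : ℕ, k ≤ 3 → ∀ t : Fin k → ℕ, (∀ i, (t i).Prime) → Function.Injective t →
      ((∏ i, t i) % 8 = 5 ∨ (∏ i, t i) % 8 = 7) → monskySelmerRankOdd t = 1 →
      (congruentNumberCurve (∏ i, t i)).analyticRank = 1 ∧ BSDp (congruentNumberCurve (∏ i, t i)) 2) :
    ∀ p q r : ℕ, p.Prime → q.Prime → r.Prime → p % 8 = 5 → q % 8 = 7 → r % 8 = 7 → q ≠ r →
      jacobiSym q p = -1 → jacobiSym r p = -1 →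
        (congruentNumberCurve (p * q * r)).analyticRank = 1 ∧
          BSDp (congruentNumberCurve (p * q * r)) 2 :=
  silentFiveSevenSeven_of_oddRung_three (h 3 le_rfl)

/-- **THE ODD LAW BELOW THE BLIND LINE IS the odd `U₃⁰` sentence.** Modulo the four displayed facts {`hTYZ`
(TYZ §3),
`hGZK`, `hM` (Monsky 1994 odd), `hR` (Rédei–Reichardt)}: the uniform odd sentence «for `k` distinct
primes with `∏ tᵢ ≡ 5, 7 (mod 8)` and `s = 1`: `r_an = 1` and `BSD(E_n, 2)`» holds for ALL `k ≤ 3` IFF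
the odd `U₃⁰` sentence holds — rungs `0, 1, 2` are vacuous / theorems (§5), rung `3` is
§6. So ONE odd token quantified from `k = 1` (or `0`) asserts, below the blind rungs `k ≥ 4`, EXACTLY
the odd `U₃⁰` sentence and nothing more (⟹ with no fact: `silentFiveSevenSeven_of_oddLaw_le_three`).
[cite: TianYuanZhang2017, Thm. 1.2, Thm. 3.5 and §1 (1.1)]
[cite: HeathBrown1994SelmerCongruentII, Appendix (Monsky), typescript p. 39 L10–L33]
[cite: Miller2011LMS, Def. 1.1 (arXiv:1010.2431 p. 3)] -/
theorem oddLaw_le_three_iff_silentFiveSevenSeven (hTYZ : tyz_genusPointData)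
    (hGZK : rank_eq_analyticRank_of_analyticRank_le_one) (hM : monsky_card_selmerGroup_two_odd)
    (hR : redeiReichardt_fourTwoCard_classGroup) :
    (∀ k : ℕ, k ≤ 3 → ∀ t : Fin k → ℕ, (∀ i, (t i).Prime) → Function.Injective t →
      ((∏ i, t i) % 8 = 5 ∨ (∏ i, t i) % 8 = 7) → monskySelmerRankOdd t = 1 →
      (congruentNumberCurve (∏ i, t i)).analyticRank = 1 ∧ BSDp (congruentNumberCurve (∏ i, t i)) 2) ↔
    (∀ p q r : ℕ, p.Prime → q.Prime → r.Prime → p % 8 = 5 → q % 8 = 7 → r % 8 = 7 → q ≠ r →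
      jacobiSym q p = -1 → jacobiSym r p = -1 →
        (congruentNumberCurve (p * q * r)).analyticRank = 1 ∧
          BSDp (congruentNumberCurve (p * q * r)) 2) := by
  refine ⟨silentFiveSevenSeven_of_oddLaw_le_three, fun hC k hk => ?_⟩
  interval_cases k
  · intro t _ _ h8 _
    exfalso
    rw [Finset.univ_eq_empty, Finset.prod_empty] at h8
    omega
  · exact oddRung_one hTYZ hGZK hM hR
  · exact oddRung_two hTYZ hGZK hM hR
  · exact oddRung_three_of_silentFiveSevenSeven hTYZ hGZK hM hR hC

end Law

end Summit.BirchSwinnertonDyer.Rank1Residual.P2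

end
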